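import Literature.Probability.Percolation.SlabRSWGluingSegExtB
import HarnessLib

/-!
# Newman–Tassion–Wu 2017, Theorem 3.7: the LINEAR regime from a located-gadget supply

Topic: `Literature/Probability/Percolation`. The tree proves NTW's gluing lemma in two regimes from two
kinds of supplies: the linear regime (`real_evAB_inter_evNear_le_of_gadgets`: one `GadgetSpec` per
configuration of `𝒳_ρ`) and the high-probability regime (`glue_highProb_of_gadgets_entR`: a located
`GadgetAt` at every entry cell of `U_ent ∩ R`). This file shows that the second kind of supply yields the
first when `C` is far from `S`: every lattice configuration of `𝒳_ρ` HAS an entry cell in `R̄` (the first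
vertex within `ρ` of `Γ̄` on an open path from `C̄`), so a located supply gives the linear regime too —
for every geometry at once (extended rectangle, segment target, L-shaped domain, …).

* `GlueData.exists_mem_UentR_of_evXn`, `real_evAB_inter_evNear_le_of_gadgetsAt`,
  `glue_linear_segExt` (the segment-target / top-extension geometry, linear regime, unconditional).

## Sources

* C. M. Newman, V. Tassion, W. Wu, *Critical percolation and the minimal spanning tree in slabs*,
  Comm. Pure Appl. Math. 70 (2017), arXiv:1512.09107: §3.2, Theorem 3.7 and its proof (step (1): the
  vertex `w′` and the path `π`; Remark 3: `h₀(x) ≥ c₀ x`) [NewmanTassionWu2017].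
-/

noncomputable section

namespace Literature.Probability.Percolation

open MeasureTheory LatticeModels SimpleGraph

namespace NTW17

variable {k : ℕ}

namespace GlueData

variable {Q : GlueData} {ρ : ℕ}

/-- **Every lattice configuration of `𝒳_ρ` has an entry cell in `R̄`** (`C` at sup-distance `> ρ` from
`S`): on an open self-avoiding path from `C̄` inside `R̄` reaching the `ρ`-neighbourhood of `Γ̄`, the
first vertex within `ρ` of `Γ̄` and its predecessor form an entry edge.
[cite: NewmanTassionWu2017, §3.2 (proof of Theorem 3.7, step (1): the vertex w′)] -/
theorem exists_mem_UentR_of_evXn (hfar : ∀ c ∈ Q.C, ∀ s ∈ Q.S, c ∉ sqBox s ρ)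
    {ω : BondConfig (slab 3 k)} (hω : ω ⊆ (slabGraph 3 k).edgeSet) (hX : ω ∈ Q.evXn k ρ) :
    ∃ y, y ∈ Q.UentR k ρ ω := by
  have hA : ω ∈ Q.evAB k := hX.1.1
  obtain ⟨c₀, hc₀, q, hj, hnear⟩ := hX.2
  have hγS : ∀ g ∈ Q.γ k ω, g ∈ slabLift k Q.S := (Q.γ_spec hA).1.subset
  obtain ⟨L, hL⟩ := exists_isOSAP_of_openConnIn hj
  have hqL : q ∈ L := by
    have := hL.last_mem hL.ne_nil
    rw [Set.mem_singleton_iff] at this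
    rw [← this]; exact List.getLast_mem _
  obtain ⟨l, x₁, l₂, hLeq, hx₁, hl⟩ :=
    exists_first_split (p := fun x => Near k (Q.γ k ω) ρ (planar k x)) L ⟨q, hqL, hnear⟩
  have hc₀far : ¬Near k (Q.γ k ω) ρ (planar k c₀) := by
    rintro ⟨g, hg, hc⟩
    exact hfar (planar k c₀) hc₀ (planar k g) (hγS g hg) hc
  have hhead : L.head hL.ne_nil = c₀ := by
    have := hL.head_mem hL.ne_nil
    rwa [Set.mem_singleton_iff] at this
  have hl0 : l ≠ [] := by
    rintro rfl
    simp only [List.nil_append] at hLeq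
    have : L.head hL.ne_nil = x₁ := by simp [hLeq]
    rw [hhead] at this
    rw [this] at hc₀far
    exact hc₀far hx₁
  obtain ⟨l₁, x₀, hlx⟩ := l.eq_nil_or_concat.resolve_left hl0
  rw [List.concat_eq_append] at hlx
  subst hlx
  have hchain := hL.chain
  rw [hLeq, show (l₁ ++ [x₀]) ++ x₁ :: l₂ = l₁ ++ (x₀ :: x₁ :: l₂) by simp] at hchain
  have hedge : s(x₀, x₁) ∈ ω ∧ x₀ ≠ x₁ :=
    (List.isChain_cons_cons.1 (List.isChain_append.1 hchain).2.1).1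
  have hadj : (slabGraph 3 k).Adj x₀ x₁ := (SimpleGraph.mem_edgeSet _).1 (hω hedge.1)
  have hx₀far : ¬Near k (Q.γ k ω) ρ (planar k x₀) := hl x₀ (by simp)
  have hx₁R : x₁ ∈ slabLift k Q.R := hL.subset x₁ (by rw [hLeq]; simp)
  -- the prefix joins `c₀` to `x₀` off the neighbourhood, inside `R̄`
  have hjoin : Q.JoinedFar k ρ ω x₀ := by
    obtain ⟨c, rest, hlc⟩ := List.exists_cons_of_ne_nil hl0
    have hc : c = c₀ := by
      have h1 : L.head hL.ne_nil = c := by simp [hLeq, hlc]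
      rw [← hhead, h1]
    rw [hc] at hlc
    have hpre : (l₁ ++ [x₀]).IsChain (fun a b => s(a, b) ∈ ω ∧ a ≠ b) := by
      have := hL.chain
      rw [hLeq, show (l₁ ++ [x₀]) ++ x₁ :: l₂ = (l₁ ++ [x₀]) ++ (x₁ :: l₂) by simp] at this
      exact (List.isChain_append.1 this).1
    rw [hlc] at hpre
    have hsub : ∀ x ∈ c₀ :: rest, x ∈ slabLift k Q.R ∩ {v | ¬Near k (Q.γ k ω) ρ (planar k v)} := by
      intro x hx
      have hxl : x ∈ l₁ ++ [x₀] := by rw [hlc]; exact hx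
      exact ⟨hL.subset x (by rw [hLeq]; exact List.mem_append_left _ hxl), hl x hxl⟩
    have hconn := openConnIn_of_isChain c₀ rest hpre hsub
    have hlast : (c₀ :: rest).getLast (List.cons_ne_nil c₀ rest) = x₀ := by
      simp only [← hlc, List.getLast_append_singleton]
    rw [hlast] at hconn
    exact ⟨c₀, hc₀, hconn⟩
  exact ⟨planar k x₁, ⟨⟨hx₁, x₀, x₁, rfl, hadj, hx₀far, hjoin⟩, hx₁R⟩⟩

end GlueData

/-- **Thm 3.7 in the LINEAR regime from a located supply**: for any gluing datum `Q` with `C` at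
sup-distance `> ρ` from `S`, located gadgets of radius `r` at every entry cell (of every lattice
configuration of `𝒳_ρ`) give `P_p[A ⟷^S B, C̄ ⟷^{R̄} 𝒩(Γ̄, ρ)] ≤ (1 + λ_p^s) · P_p[C ⟷^R A]`,
`s = 3(5k+4)(4r+1)²`. [cite: NewmanTassionWu2017, Theorem 3.7 with Remark 3 (h₀(x) ≥ c₀ x)] -/
theorem real_evAB_inter_evNear_le_of_gadgetsAt {Q : GlueData} {ρ r : ℕ}
    (hfar : ∀ c ∈ Q.C, ∀ s ∈ Q.S, c ∉ sqBox s ρ)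
    (hgad : ∀ ω : BondConfig (slab 3 k), ω ⊆ (slabGraph 3 k).edgeSet → ω ∈ Q.evXn k ρ →
      ∀ y ∈ Q.UentR k ρ ω, ∃ ω', GadgetAt Q k r ω ω' y)
    (p : unitInterval) (hp0 : 0 < (p : ℝ)) (hp1 : (p : ℝ) < 1) :
    (bondPercolation (slabGraph 3 k) p).real (Q.evAB k ∩ Q.evNear k ρ) ≤
      (1 + (2 / min (p : ℝ) (1 - p)) ^ (3 * ((5 * k + 4) * (2 * (2 * r) + 1) ^ 2))) *
        (bondPercolation (slabGraph 3 k) p).real (Q.evCA k) := by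
  refine real_evAB_inter_evNear_le_of_gadgets p hp0 hp1 fun ω hω hX => ?_
  obtain ⟨y, hy⟩ := GlueData.exists_mem_UentR_of_evXn hfar hω hX
  obtain ⟨ω', hω'⟩ := hgad ω hω hX y hy
  exact ⟨ω', hω'.toGadgetSpec⟩

/-- **GL, LINEAR regime, segment target with a top extension — unconditional**: for every
`SegExtSetup` `W` with `y₂ + 2ρ + 6 ≤ d`, `dist*(A, C) > 4ρ + 8`, `dist*(C, S) > 2ρ + 3` (`k ≥ 1`, `ρ ≥ 2`)
and `0 < p < 1`: `P_p[A ⟷^S B, C̄ ⟷^{R̄} 𝒩(Γ̄, ρ)] ≤ (1 + λ_p^s) · P_p[C ⟷^R A]`, `s = 3(5k+4)(4ρ+13)²`.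
[cite: NewmanTassionWu2017, Theorem 3.7 with Remark 3 (linear regime)] -/
theorem glue_linear_segExt (W : SegExtSetup) (hk : 1 ≤ k) {ρ : ℕ} (hρ : 2 ≤ ρ)
    (hBtop : W.y₂ + 2 * ρ + 6 ≤ W.d)
    (hsep : ∀ a' ∈ W.A, ∀ c' ∈ W.C, c' ∉ sqBox a' (4 * ρ + 8))
    (hfarC : ∀ c' ∈ W.C, ∀ s' ∈ W.S, c' ∉ sqBox s' (2 * ρ + 3))
    (p : unitInterval) (hp0 : 0 < (p : ℝ)) (hp1 : (p : ℝ) < 1) :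
    (bondPercolation (slabGraph 3 k) p).real (W.Q.evAB k ∩ W.Q.evNear k ρ) ≤
      (1 + (2 / min (p : ℝ) (1 - p)) ^ (3 * ((5 * k + 4) * (2 * (2 * (ρ + 3)) + 1) ^ 2))) *
        (bondPercolation (slabGraph 3 k) p).real (W.Q.evCA k) :=
  real_evAB_inter_evNear_le_of_gadgetsAt (Q := W.Q) (fun c' hc' s' hs' h => hfarC c' hc' s' hs' (sqBox_mono _ (by omega) h))
    (fun _ω hω hX _y hy => exists_gadgetAt_segExt hk hρ hBtop hsep hfarC hω hX hy) p hp0 hp1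

end NTW17

end Literature.Probability.Percolation

end
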